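import Literature.AnabelianGeometry.AbsoluteAnabelian.AbsTopICharacterRank
import Literature.AnabelianGeometry.AbsoluteAnabelian.AbsTopIChains
import HarnessLib

/-!
# [AbsTopI] Lemma 4.5 (iii)(iv)(v) — SUB-DAG of the printed proof (statements only)

S. Mochizuki, *Topics in Absolute Anabelian Geometry I: Generalities* [MochizukiAbsTopI2012],
Lemma 4.5 "Cuspidal Decomposition Groups", kurims manuscript (lit key `paper:url-11ac98ba15fc`)
statement pp. 53 l. 70 – 55 l. 12, proof p. 55 l. 13–19, read on the page.  The printed proof of
(iii)(iv)(v) is BY CITATION: "(iii) follows immediately from [Mzk12], Proposition 2.4, (iv), (vii);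
the proof of [Mzk12], Corollary 2.7, (i). (iv) is [in light of (iii)] precisely a summary of the
argument of [Mzk12], Theorem 1.6, (i). (v), (vi) follow immediately from [Mzk12], Proposition 1.2,
(i), (ii)" — where [Mzk12] = [CombGC] (S. Mochizuki, *A combinatorial version of the Grothendieck
conjecture*, Tohoku Math. J. 59 (2007); kurims manuscript `paper:url-6994f81053dc`, Def. 2.3 p. 18,
Prop. 2.4 pp. 19–20, Cor. 2.7 (i) + proof pp. 22–23, Thm. 1.6 (i) + proof pp. 13–14, Prop. 1.2
p. 8, read on the page).  Item (iv) is taken in the AMENDED form of [IUTchI] Rmk. 1.2.2 (ii) / the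
author's Comments (2024) (1), exactly as the parent typing `SatisfiesCuspidalCriterion` does.

D-0068 (1) statements-first SUB-DAG (abc-iut cell, layer L4, SUBDAG-WANTED (L4) v1 row
«AbsTopI:Lem4.5 (iii)(iv)(v)», seat abc-iut-w5-d062; companion table
`plan/L4/SUBDAG-AbsTopI-Lem45.md`): one `def … : Prop` per INTERMEDIATE STATEMENT of that proof,
over the BUILT parents' vocabulary — abc-iut-L4's `AbsTopI.twist` / `quasiTrivialRank` / `dChi` /
`IsQCyclotomicOfWeightK` / `RealisedWeight` / `Lem45iii_*` (AbsTopICharacterRank.lean) and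
`FundamentalExtension.CuspCountData` / `SatisfiesCuspidalCriterion` / `IsMaximalCuspidalCandidate` /
`CuspidalAlgorithm` (AbsTopIChains.lean).  Typing policy θ of the parents is kept: the `G`-module
`V = H^{ab} ⊗ ℚ_l`, the number of cusps and the maximal pro-`l` quotient `H_*` with its family of cusp
inertia subgroups are ABSTRACT INPUT DATA (their construction from a curve is the étale-`π₁` model);
every sub-node is a `Prop` about such data.  Sub-nodes marked ALGEBRA are provable over Mathlib as they
stand (no geometry); the others transcribe the cited [CombGC] statements at this abstraction level.
NO proofs, NO instances, NO notation; nothing here is a fact to be assumed — each decl is an OPEN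
sub-node (status ∅).  HONEST FRAMING: refereed pre-IUT anabelian geometry; typed ≠ proved; nothing
here bears on [IUTchIII] Cor. 3.12.
-/

noncomputable section

open scoped Classical

namespace Literature.AnabelianGeometry.AbsoluteAnabelian.AbsTopI

universe u v w w'

/-! ## §A. Sub-nodes of (iii): the weight calculus of [CombGC] §2 at the level of `ℚ_l[G]`-modules -/

section Weights

variable {G : Type u} [Group G] [TopologicalSpace G]
variable {K : Type v} [Field K] {M : Type w} [AddCommGroup M] [Module K M]
variable {V : Type w'} [AddCommGroup V] [Module K V]

/-- [CombGC] Def. 2.3 (ii) "the `l`-weight `w` rank of `M`" := "the quasi-trivial rank of `M(ψ⁻¹)`"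
for `ψ` a `ℚ`-cyclotomic character of weight `w` — as a RELATION (`n` is AN `l`-weight-`w` rank of
`M`, computed with SOME such `ψ`); its independence of `ψ` is the sub-node `WeightRankIndependent`.
[cite: MochizukiCombGC2007, Def. 2.3 (ii) p.18] [cite: MochizukiAbsTopI2012, Lemma 4.5 (iii) p.54] -/
def HasWeightRank (χcyclo : G →* Kˣ) (ρ : G →* (M ≃ₗ[K] M)) (w : ℚ) (n : ℕ) : Prop :=
  ∃ ψ : G →* Kˣ, IsQCyclotomicOfWeightK χcyclo ψ w ∧ quasiTrivialRank (twist ρ ψ⁻¹) = n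

/-- SUB-NODE A1 (ALGEBRA; [CombGC] Prop. 2.4 (iv), last sentence, p. 19: "any two `ℚ`-cyclotomic
characters `J → ℤ_l^×` of the same weight necessarily coincide on some open subgroup", in the
power-equivalence form used by [AbsTopI] Lemma 4.5 (ii)): two characters that are `ℚ`-cyclotomic of
the same weight relative to `χ^{cyclo}` have a common positive power.  (With the EXACT convention
`χ^b = (χ^{cyclo})^a` of [AbsTopI] p. 54 this is the one-line computation
`χ₁^{b₁b₂} = (χ^{cyclo})^{a₁b₂} = (χ^{cyclo})^{a₂b₁} = χ₂^{b₁b₂}`.)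
[cite: MochizukiCombGC2007, Prop. 2.4 (iv) p.19] [cite: MochizukiAbsTopI2012, Lemma 4.5 (iii) p.54] -/
def SameWeightPowerEquivalent (χcyclo : G →* Kˣ) : Prop :=
  ∀ (χ₁ χ₂ : G →* Kˣ) (w : ℚ), IsQCyclotomicOfWeightK χcyclo χ₁ w → IsQCyclotomicOfWeightK χcyclo χ₂ w →
    ∃ n : ℕ, 0 < n ∧ ∀ g : G, χ₁ g ^ n = χ₂ g ^ n

/-- SUB-NODE A2 (ALGEBRA; [CombGC] Def. 2.3 (ii) bracket "[One verifies immediately that the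
`l`-weight `w` rank is independent of the choice of `ψ`.]"): the `l`-weight-`w` rank is well defined —
for continuous characters this is A1 + [AbsTopI] Lemma 4.5 (ii) (`dChi_eq_of_powerEquivalent`'s
mechanism `quasiTrivialRank_twist_eq`); print's characters are continuous, and the statement is
made for continuous `ψ` (`Continuous ψ` into `Kˣ`, the parent's convention in
`dChi_eq_of_powerEquivalent`; a discontinuous finite-order twist need not have an open kernel).
[cite: MochizukiCombGC2007, Def. 2.3 (ii) p.18] -/
def WeightRankIndependent [TopologicalSpace K] (χcyclo : G →* Kˣ) (ρ : G →* (M ≃ₗ[K] M)) : Prop :=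
  ∀ (w : ℚ) (ψ ψ' : G →* Kˣ), Continuous ψ → Continuous ψ' →
    IsQCyclotomicOfWeightK χcyclo ψ w → IsQCyclotomicOfWeightK χcyclo ψ' w →
      quasiTrivialRank (twist ρ ψ⁻¹) = quasiTrivialRank (twist ρ ψ'⁻¹)

/-- SUB-NODE A3 ([CombGC] Prop. 2.4 (iii) p. 19, transcribed for the `G`-module `V = H^{ab} ⊗ ℚ_l`
of a STURDY covering: "there exists a positive integer `m ≤ 2m(G)` such that
`det(M_G ⊗ ℤ_l)^{⊗2}(−m)` is quasi-trivial"): some open subgroup of finite index acts on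
`det(V)^{⊗ 2} ⊗ (χ^{cyclo})^{−m}` trivially, `0 < m ≤ 2·dim V`.  INPUT of (iii), first sentence.
[cite: MochizukiCombGC2007, Prop. 2.4 (iii) p.19] [cite: MochizukiAbsTopI2012, Lemma 4.5 (iii) p.54] -/
def DetSqQuasiCyclotomic [FiniteDimensional K V] (χcyclo : G →* Kˣ) (ρV : G →* (V ≃ₗ[K] V)) : Prop :=
  ∃ m : ℕ, 0 < m ∧ m ≤ 2 * Module.finrank K V ∧
    ∃ U : Subgroup G, IsOpen (U : Set G) ∧ U.FiniteIndex ∧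
      ∀ g ∈ U, detChar ρV g ^ 2 = χcyclo g ^ m

/-- SUB-NODE A4 (ALGEBRA; the step "[CombGC] Prop. 2.4 (iii) ⇒ (iv)": "Assertion (iv) follows
formally from assertion (iii); the definitions; the fact that `ℤ_l^×` contains a torsion-free open
subgroup", p. 20): a character agreeing with a power of `χ^{cyclo}` on an open subgroup of finite
index is `ℚ`-cyclotomic in the EXACT sense of [AbsTopI] p. 54 (kill the finite quotient by a further
power), with the same sign of weight.  Stated as the implication A3 ⇒ (iii) first sentence.
[cite: MochizukiCombGC2007, Prop. 2.4 (iv) p.19] [cite: MochizukiAbsTopI2012, Lemma 4.5 (iii) p.54] -/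
def DetQCyclotomicOfDetSq [FiniteDimensional K V] (χcyclo : G →* Kˣ) (ρV : G →* (V ≃ₗ[K] V)) :
    Prop :=
  DetSqQuasiCyclotomic χcyclo ρV → Lem45iii_det χcyclo ρV

/-- SUB-NODE A5 (ALGEBRA): the cyclotomic character itself is `ℚ`-cyclotomic of weight `2`
(`a = b = 1` in "`w = 2a/b`", [CombGC] Def. 2.3 (ii) / [AbsTopI] p. 54), and the trivial character is
`ℚ`-cyclotomic of weight `0`. [cite: MochizukiCombGC2007, Def. 2.3 (ii) p.18] -/
def CycloWeightTwoTrivialWeightZero (χcyclo : G →* Kˣ) : Prop :=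
  IsQCyclotomicOfWeightK χcyclo χcyclo 2 ∧ IsQCyclotomicOfWeightK χcyclo 1 0

/-- SUB-NODE A6 (ALGEBRA): the weight `0` is always realised by `(V ⊕ ℚ_l)` — the trivial summand
"`ℚ_l` [equipped with the trivial `G`-action]" of [AbsTopI] Lemma 4.5 (iii) p. 54 has quasi-trivial
rank `1 ≠ 0` (this is why print adjoins it: it pins the minimum weight at `0`).
[cite: MochizukiAbsTopI2012, Lemma 4.5 (iii) p.54] -/
def ZeroWeightRealised (χcyclo : G →* Kˣ) (ρV : G →* (V ≃ₗ[K] V)) : Prop :=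
  RealisedWeight χcyclo ρV 0

/-- SUB-NODE A7 ([CombGC] Prop. 2.4 (vii) p. 20, transcribed for `V = H^{ab} ⊗ ℚ_l` with `H`
"sufficiently small" — print: "for every sufficiently small open subgroup `Π_{G′} ⊆ Π_G`, the subset
`{0} ∪ w_l(M_{G′} ⊗ ℤ_l) ⊆ ℚ` is invariant with respect to the automorphism `λ ↦ 2 − λ` of `ℚ`; in
particular, the sum of the maximum and minimum elements of this [finite] subset is equal to `2`"):
the set of weights realised by `V ⊕ ℚ_l` (= `{0} ∪ w_l(V)`, cf. A6) is FINITE and symmetric under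
`λ ↦ 2 − λ`.  INPUT of (iii), second sentence.
[cite: MochizukiCombGC2007, Prop. 2.4 (vii) p.20] [cite: MochizukiAbsTopI2012, Lemma 4.5 (iii) p.54] -/
def RealisedWeightsSymmetric (χcyclo : G →* Kˣ) (ρV : G →* (V ≃ₗ[K] V)) : Prop :=
  {w : ℚ | RealisedWeight χcyclo ρV w}.Finite ∧
    ∀ w : ℚ, RealisedWeight χcyclo ρV w ↔ RealisedWeight χcyclo ρV (2 - w)

/-- SUB-NODE A8 (ALGEBRA; the assembly step of (iii), second sentence, as print derives it in the
proof of [CombGC] Cor. 2.7 (i) p. 23: "ι preserves positive and null `ℚ`-cyclotomic characters …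
Thus, by Proposition 2.4, (vii), … ι preserves the `ℚ`-cyclotomic characters of weight `2`"): from
A1, A5, A6, A7 — the realised weights have max `w^*` and min `w_* = 0` with `w^* + w_* = 2`, so every
`χ^* · χ_*` has weight `2` and is power-equivalent to `χ^{cyclo}`.  Stated as the implication to the
parent predicate `Lem45iii_cycloClass`. [cite: MochizukiAbsTopI2012, Lemma 4.5 (iii) p.54] -/
def CycloClassOfSymmetry (χcyclo : G →* Kˣ) (ρV : G →* (V ≃ₗ[K] V)) : Prop :=
  SameWeightPowerEquivalent χcyclo → CycloWeightTwoTrivialWeightZero χcyclo →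
    ZeroWeightRealised χcyclo ρV → RealisedWeightsSymmetric χcyclo ρV → Lem45iii_cycloClass χcyclo ρV

/-- SUB-NODE A9 ([CombGC] proof of Cor. 2.7 (i), p. 23, the COUNTING step, transcribed: "the rank
of `M^{cusp}_{G′}` may be computed as the difference between the `l`-weight `2` and `l`-weight `0`
ranks of `M_{G′}` [cf. Proposition 2.4, (ii); Remark 1.3.1]; moreover, [cf. Remark 1.3.1] this data
allows one to compute `r(G′)`" — for the one-vertex semi-graph of the smooth covering determined by
`H`, `rank M^{cusp} = r − 1`): with `V = H^{ab} ⊗ ℚ_l` and `numCusps` the number of cusps of that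
covering, `τ(V((χ^{cyclo})⁻¹)) − τ(V) = numCusps − 1`.  INPUT of (iii), third sentence.
[cite: MochizukiCombGC2007, Cor. 2.7 (i) proof p.23] [cite: MochizukiAbsTopI2012, Lemma 4.5 (iii) p.54] -/
def CuspCountViaWeights (χcyclo : G →* Kˣ) (ρV : G →* (V ≃ₗ[K] V)) (numCusps : ℕ) : Prop :=
  (quasiTrivialRank (twist ρV χcyclo⁻¹) : ℤ) - quasiTrivialRank ρV + 1 = numCusps

/-- SUB-NODE A10 (ALGEBRA; the identification `τ(Hom_{ℚ_l}(M, ℚ_l)) = τ(M)` implicit in reading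
`d_χ(M) = τ(M(χ⁻¹)) − τ(Hom(M, ℚ_l))` ([AbsTopI] Lemma 4.5 (ii) p. 54) as "weight-`2` rank minus
weight-`0` rank" ([CombGC] p. 23): dualising exchanges a character `χ` with `χ⁻¹`, so it preserves
the quasi-trivial (`χ` = finite-order) part). [cite: MochizukiAbsTopI2012, Lemma 4.5 (ii) p.54] -/
def DualRankEq [FiniteDimensional K V] (ρV : G →* (V ≃ₗ[K] V)) : Prop :=
  quasiTrivialRank (dualRep ρV) = quasiTrivialRank ρV

/-- SUB-NODE A11 (ALGEBRA; assembly of (iii), third sentence "the divisor of cusps … is a disjoint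
union of `d_χ(H^{ab} ⊗ ℚ_l) + 1` copies of `Spec(k̃)`" from A9 + A10): stated as the implication to
the parent predicate `Lem45iii_cuspCount`. [cite: MochizukiAbsTopI2012, Lemma 4.5 (iii) p.54] -/
def CuspCountOfWeights [FiniteDimensional K V] (χcyclo : G →* Kˣ) (ρV : G →* (V ≃ₗ[K] V))
    (numCusps : ℕ) : Prop :=
  CuspCountViaWeights χcyclo ρV numCusps → DualRankEq ρV → Lem45iii_cuspCount χcyclo ρV numCusps

end Weights

end Literature.AnabelianGeometry.AbsoluteAnabelian.AbsTopI

/-! ## §B. Sub-nodes of (iv) [amended]: cusp inertia subgroups of `H_*` via cusp counts -/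

namespace Literature.AnabelianGeometry.AbsoluteAnabelian.FundamentalExtension

open scoped Pointwise

universe u

section CuspInertia

variable {Hstar : Type u} [Group Hstar] [TopologicalSpace Hstar] [IsTopologicalGroup Hstar]

/-- ABSTRACT INPUT DATA for (iv)/(v): on the maximal pro-`l` quotient `H ↠ H_*` of a torsion-free
pro-`Σ` characteristic open `H ⊆ Δ` ([AbsTopI] Lemma 4.5 (iv) p. 54) — the family of CUSP INERTIA
SUBGROUPS of `H_*` (images of the `I_x ∩ H`, all `H_*`-conjugates, for the cusps `x` of the covering of
`X ×_k k̃` determined by `H`; = the cuspidal edge-like subgroups of the pro-`l` PSC-fundamental group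
`Π_G = H_*` of the one-vertex semi-graph of anabelioids of that smooth curve, [CombGC] Def. 1.1 (ii)),
indexed by an abstract cusp set, together with the cusp numbers `r(V)` of the coverings determined by
open `V ⊆ H_*` (abc-iut-L4-t4's `CuspNumberData`).  Typing policy θ: data, not a construction.
[cite: MochizukiAbsTopI2012, Lemma 4.5 (iv) p.54] [cite: MochizukiCombGC2007, Def. 1.1 (ii) p.6] -/
structure CuspInertiaData (Hstar : Type u) [Group Hstar] [TopologicalSpace Hstar] : Type (u + 1) where
  /-- the cusps of the covering determined by `H` (over `k̃`) -/
  Cusp : Type u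
  /-- finitely many cusps -/
  [finite : Finite Cusp]
  /-- a cusp inertia subgroup `I_x ⊆ H_*` for each cusp (a representative of its conjugacy class) -/
  inertia : Cusp → Subgroup Hstar
  /-- the cusp numbers `V ↦ r(V)` of the coverings determined by open subgroups `V ⊆ H_*` -/
  r : CuspNumberData Hstar

variable (C : CuspInertiaData Hstar)

/-- The set of all cusp inertia subgroups of `H_*`: the `H_*`-conjugates of the `I_x`.
[cite: MochizukiAbsTopI2012, Lemma 4.5 (iv) p.54] -/
def CuspInertiaData.inertiaSet : Set (Subgroup Hstar) :=
  {I | ∃ (x : C.Cusp) (h : Hstar), I = MulAut.conj h • C.inertia x}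

/-- SUB-NODE B1 ([AbsTopII] Prop. 1.3 (i) / [CombGC] Remark 1.1.3, the structure of cusp inertia in a
pro-`l` surface group): each cusp inertia subgroup of `H_*` is closed and `≅ ℤ_l`
(abc-iut-L4-t6's intrinsic `AbsTopII.IsFreeProSigmaCyclic {l}`), as the parent criterion demands of
its candidates. [cite: MochizukiAbsTopI2012, Lemma 4.5 (iv) p.54] [cite: MochizukiCombGC2007, Rem. 1.1.3 p.7] -/
def CuspInertiaData.InertiaProcyclic (l : ℕ) : Prop :=
  ∀ I ∈ C.inertiaSet, IsClosed (I : Set Hstar) ∧ AbsTopII.IsFreeProSigmaCyclic {l} ↥I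

/-- SUB-NODE B2 ((iii), third sentence, applied to EVERY characteristic open `J ⊆ H_*`, i.e. the
dictionary between abc-iut-L4-t4's two abstract count data: "the divisor of cusps of the covering …
determined by [`J`] is a disjoint union of `d_{χ^{cyclo}}(J^{ab} ⊗ ℚ_l) + 1` copies of `Spec(k̃)`"):
`r(V) = d(V) + 1` for every open `V ⊆ H_*` (print applies `d` to `I·J` and, in the amended form,
to `I^l·J`, which are open but not characteristic — so the dictionary is stated on all open
subgroups, exactly the domain on which the parent's `SatisfiesCuspidalCriterion` evaluates `d`).
This is how "(iv) is [in light of assertion (iii)] …" consumes (iii).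
[cite: MochizukiAbsTopI2012, Lemma 4.5 (iii)(iv) p.54] -/
def CuspCountDictionary (d : CuspCountData Hstar) (r : CuspNumberData Hstar) : Prop :=
  ∀ V : Subgroup Hstar, IsOpen (V : Set Hstar) → r.r V = d.d V + 1

/-- "the covering corresponding to `J ⊆ V` is totally ramified at some cusp" in group-theoretic form
over the cusp inertia data: some cusp inertia subgroup of `H_*`, cut down to `V`, surjects onto `V/J`.
([CombGC] proof of Thm. 1.6 (i) p. 14 "cuspidally [purely] totally ramified"; [AbsAnab] Lem. 1.3.9.)
[cite: MochizukiCombGC2007, Thm. 1.6 (i) proof p.14] [cite: MochizukiAbsTopI2012, Lemma 4.5 (iv) p.54] -/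
def CuspInertiaData.TotallyRamifiedAtSomeCusp (V J : Subgroup Hstar) : Prop :=
  ∃ I ∈ C.inertiaSet, (I ⊓ V) ⊔ J = V

/-- SUB-NODE B3 ([IUTchI] Rmk. 1.2.2 (i)(ii) = the AMENDMENT of [AbsAnab] Lem. 1.3.9 / [AbsTopI]
Lem. 4.5 (iv), as typed by the parents' `TotallyRamifiedCriterion` / `SatisfiesCuspidalCriterion`:
for a closed `I ≅ ℤ_l` and a characteristic open `J` with `J ≠ I·J`, the cyclic covering
`J ⊆ I·J` is totally ramified at some cusp iff the degree-`l` layer `I^l·J ⊆ I·J` satisfies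
`r(I^l·J) < l · r(I·J)` — the Riemann–Hurwitz count for a cyclic degree-`l` covering of curves:
`r_W = l·r_V − (l − 1)·#{ramified cusps}`). [cite: Mochizuki2012, IUTchI Rmk 1.2.2 (i)(ii) p.40]
[cite: MochizukiAbsTopI2012, Lemma 4.5 (iv) p.54] -/
def CuspInertiaData.TotRamIffCount (l : ℕ) : Prop :=
  ∀ I J : Subgroup Hstar, IsClosed (I : Set Hstar) → AbsTopII.IsFreeProSigmaCyclic {l} ↥I →
    J.Characteristic → IsOpen (J : Set Hstar) → J ≠ I ⊔ J →
      (C.TotallyRamifiedAtSomeCusp (I ⊔ J) J ↔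
        C.r.r (Subgroup.closure ((fun x : Hstar => x ^ l) '' (I : Set Hstar)) ⊔ J) < l * C.r.r (I ⊔ J))

/-- SUB-NODE B4 ("precisely a summary of the argument of [Mzk12], Theorem 1.6, (i)" — [CombGC]
p. 14: "the cuspidal edge-like subgroups of `Π_G` … are precisely the maximal closed subgroups `A`
such that, for every open normal subgroup `A′ ⊆ A`, the inclusion `A′ ⊆ A` descends to a cuspidally
purely totally ramified Galois finite étale covering", read for the free pro-`l` group `H_*` with the
quantification of the amended (iv) over characteristic open `J ⊆ H_*`): the cusp inertia subgroups of
`H_*` are exactly the MAXIMAL closed subgroups `I ≅ ℤ_l` such that for every characteristic open `J`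
with `J ≠ I·J` the covering `J ⊆ I·J` is totally ramified at some cusp.
[cite: MochizukiCombGC2007, Thm. 1.6 (i) proof p.14] [cite: MochizukiAbsTopI2012, Lemma 4.5 (iv) p.54] -/
def CuspInertiaData.InertiaIffMaximalTotRam (l : ℕ) : Prop :=
  ∀ I : Subgroup Hstar, I ∈ C.inertiaSet ↔
    ((IsClosed (I : Set Hstar) ∧ AbsTopII.IsFreeProSigmaCyclic {l} ↥I ∧
        ∀ J : Subgroup Hstar, J.Characteristic → IsOpen (J : Set Hstar) → J ≠ I ⊔ J →
          C.TotallyRamifiedAtSomeCusp (I ⊔ J) J) ∧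
      ∀ I' : Subgroup Hstar, I ≤ I' →
        (IsClosed (I' : Set Hstar) ∧ AbsTopII.IsFreeProSigmaCyclic {l} ↥I' ∧
          ∀ J : Subgroup Hstar, J.Characteristic → IsOpen (J : Set Hstar) → J ≠ I' ⊔ J →
            C.TotallyRamifiedAtSomeCusp (I' ⊔ J) J) → I = I')

/-- SUB-NODE B5 (assembly of (iv) as typed by abc-iut-L4-t4: from B2 (`r = d + 1`), B3 and B4 the
parent predicate `IsMaximalCuspidalCandidate l d` characterises exactly the cusp inertia subgroups of
`H_*` — "the decomposition groups of cusps `⊆ H_*` may be characterized ["group-theoretically"] as the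
maximal closed subgroups `I ⊆ H_*` isomorphic to `ℤ_l` which satisfy the following condition …").
[cite: MochizukiAbsTopI2012, Lemma 4.5 (iv) p.54] -/
def CuspInertiaData.Lem45ivCharacterisation (l : ℕ) (d : CuspCountData Hstar) : Prop :=
  ∀ I : Subgroup Hstar, I ∈ C.inertiaSet ↔ IsMaximalCuspidalCandidate l d I

/-- The composition B2 ∧ B3 ∧ B4 ⇒ B5, as a single `Prop` (the proof obligation of the (iv) row).
[cite: MochizukiAbsTopI2012, Lemma 4.5 (iv) p.54] -/
def CuspInertiaData.Lem45ivOfSubnodes (l : ℕ) (d : CuspCountData Hstar) : Prop :=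
  CuspCountDictionary d C.r → C.TotRamIffCount l → C.InertiaIffMaximalTotRam l →
    C.Lem45ivCharacterisation l d

/-! ## §C. Sub-nodes of (v): cusps ↔ conjugacy classes of cusp inertia subgroups -/

/-- SUB-NODE C1 ("(v), (vi) follow immediately from [Mzk12], Proposition 1.2, (i), (ii)" — [CombGC]
Prop. 1.2 (i) p. 8: "If `A₁ ∩ A₂` is open in `A₁`, then … `e₁ = e₂`", for the cuspidal edge-like
subgroups of `H_*`): cusp inertia subgroups of DISTINCT cusps are not commensurable — in particular
not conjugate, so `x ↦ [I_x]` is injective into `H_*`-conjugacy classes.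
[cite: MochizukiCombGC2007, Prop. 1.2 (i) p.8] [cite: MochizukiAbsTopI2012, Lemma 4.5 (v) p.55] -/
def CuspInertiaData.DistinctCuspsNotCommensurable : Prop :=
  ∀ (x y : C.Cusp) (h : Hstar),
    IsOpen (((MulAut.conj h • C.inertia x) ⊓ C.inertia y).subgroupOf (C.inertia y) :
      Set ↥(C.inertia y)) → x = y

/-- SUB-NODE C2 ([CombGC] Prop. 1.2 (ii) p. 8: "The `Aᵢ` [… edge-like subgroups] are commensurably
terminal in `Π_G`", for the cusp inertia subgroups of `H_*`; abc-iut-L4-t1's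
`AbsoluteAnabelian.IsCommensurablyTerminal`). Used by (v) ("compatible with the natural actions by
`Π`") and (vi). [cite: MochizukiCombGC2007, Prop. 1.2 (ii) p.8] [cite: MochizukiAbsTopI2012, Lemma 4.5 (v)(vi) p.55] -/
def CuspInertiaData.InertiaCommensurablyTerminal : Prop :=
  ∀ I ∈ C.inertiaSet, AbsoluteAnabelian.IsCommensurablyTerminal I

/-- SUB-NODE C3 (assembly of (v), first sentence: "the set of cusps of the covering … determined by
`H` is in natural bijective correspondence with the set of conjugacy classes in `H_*` of decomposition
groups of cusps [as described in (iv)]" — the map `x ↦ (H_*-conjugacy class of I_x)` from cusps to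
the classes of members of `inertiaSet` is a bijection; surjective by definition of `inertiaSet`,
injective by C1). [cite: MochizukiAbsTopI2012, Lemma 4.5 (v) p.55] -/
def CuspInertiaData.CuspsBijInertiaClasses : Prop :=
  (∀ (x y : C.Cusp) (h : Hstar), MulAut.conj h • C.inertia x = C.inertia y → x = y) ∧
    ∀ I ∈ C.inertiaSet, ∃ (x : C.Cusp) (h : Hstar), I = MulAut.conj h • C.inertia x

end CuspInertia

/-- SUB-NODE C4 ((v), second/third sentences: "this correspondence is functorial in `H` and compatible
with the natural actions by `Π` on both sides. In particular, by allowing `H` to vary, this yields a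
["group-theoretic"] characterization of the decomposition groups of cusps in `Π`" — at the level of
abc-iut-L4-t4's `CuspidalAlgorithm`: an algorithm whose output on EVERY extension with cuspidal data
is the set of decomposition groups of cusps, i.e. `RecoversCusps` for all `(E, C)` of the
construction-data class; the decomposition group of a cusp is then the commensurator of its inertia
group, (vi) = the parent predicate `CuspidalData.DecompEqCommensuratorOfInertia`).
[cite: MochizukiAbsTopI2012, Lemma 4.5 (v)(vi) p.55] -/
def Lem45vRecoversAll (A : CuspidalAlgorithm.{u})
    (admissible : ∀ E : FundamentalExtension.{u}, CuspidalData E → Prop) : Prop :=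
  ∀ (E : FundamentalExtension.{u}) (C : CuspidalData E), admissible E C →
    A.RecoversCusps E C ∧ C.DecompEqCommensuratorOfInertia

end Literature.AnabelianGeometry.AbsoluteAnabelian.FundamentalExtension

end
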